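import Literature.AlgebraicGeometry.HodgeTheory.CyclicCoverPencilSaturatedRadius
import Literature.AlgebraicGeometry.HodgeTheory.CyclicCoverPencilShellFields
import Literature.AlgebraicGeometry.Motives.UniversalHypersurfaceRegularLocusChartCoeff
import Literature.AlgebraicGeometry.HodgeTheory.CyclicCoverPencilCutoffFlows
import Literature.AlgebraicGeometry.Motives.UniversalHypersurfaceRegularLocusFlowCoeff
import Literature.Geometry.Manifold.IntegralCurveSlab
import HarnessLib

/-!
# Slab points of the pencil orbits lie in the shell set; the saturated radius is a first integral there

Family `hodge`, layer `Literature/AlgebraicGeometry/HodgeTheory`; step A2c(iii) of the programme discharging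
`HodgeTheory/CyclicCoverNodalMeridianLocalMonodromyBound`. Let `F = satRadius p Θ R''' R''` be the saturated Morse radius on `𝒴°(ℂ)`
(`CyclicCoverPencilSaturatedRadius`) and `c(Q) = −b_{x₂^p}(Q)` the pencil coordinate (the coefficient vector along the pencil is `b₀ − c·e_{x₂^p}`,
`(b₀)_{x₂^p} = 0`). A point `Q` with remaining coefficients `b'(Q) = b'₀` (those of `x₃^p − f₁`), `s₀² ≤ F(Q) ≤ r₂²` (`r₂² < R''' < R''`) and
`|c(Q)| ≤ δ` lies in the shell set `K` of `CyclicCoverPencilShellFields` (its affine coordinates are in the Morse shell and `φ(y(Q)) = c(Q)` by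
`CyclicCoverPencilChartPartial`); consequently for a vector field `X` tangent to the Morse shells along `K` — `dρ̃(X) = 0` on `K`, as produced by
`exists_shell_tangent_lift` — and any scalar `f`, the saturated radius satisfies `dF(f • X)(Q) = 0` at such points.

* `pencilCoord`, `pencilCoord_eq_phi` — `c(Q) = φ(y(Q))` on the chart with `b' = b'₀`;
* `mem_shellSet_of_satRadius` — slab points with `b' = b'₀`, `|c| ≤ δ` are in the shell set;
* `mfderiv_satRadius_smul_eq_zero` — `dF(f • X) = 0` there when `dρ̃(X) = 0` on the shell set;
* `norm_sub_eq_of_forall_ne`, `coeffsOf_nodal_regPowIndex` (`(b₀)_{x₂^p} = 0`), `invariantSet` — the set `A = {b' = b'₀} ∩ {s₁² < F}`;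
* along an integral curve `γ` of a cut-off lift `cutoffScalar • X` starting in `A` (section `Orbit`): `regCoeff_orbit_eq` (`b'` conserved),
  `mfderiv_satRadius_orbit_eq_zero`, `satRadius_orbit_gt` and `orbit_mem_invariantSet` (**`A` is invariant**, via
  `Geometry/Manifold/IntegralCurveSlab`), `nodeCutoff_orbit_eq_zero`, `cutoffScalar_orbit_eq` (the node cut-off is idle along the orbit).

Everything is proved; the two definitions are concrete; no named facts.

## References

* [ArnoldGuseinzadeVarchenko2012] V. I. Arnold, S. M. Gusein-Zade, A. N. Varchenko, Singularities of Differentiable Maps II (2012), Part I §1.1, §2.1.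
* [CarlsonToledo1999] J. A. Carlson, D. Toledo, Duke Math. J. 97 (1999), §6 (kdoublept).
-/

noncomputable section

open CategoryTheory AlgebraicGeometry MvPolynomial TopologicalSpace Set Topology Filter
open scoped Manifold ContDiff
open Literature.AlgebraicGeometry.Motives Literature.AlgebraicGeometry.Motives.UniversalHypersurface
open Literature.AlgebraicGeometry.HodgeTheory.UniversalHypersurface Literature.Geometry.ComplexAnalytic Literature.Geometry.Manifold

namespace Literature.AlgebraicGeometry.HodgeTheory

variable (p : ℕ)

/-- **The pencil coordinate** `c(Q) = −b_{x₂^p}(Q)`. [cite: CarlsonToledo1999, §6 (kdoublept)] -/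
def pencilCoord (Q : ComplexPoints (regularTotal ℂ 2 p)) : ℂ := -regCoeff ℂ 2 p Q (regPowIndex 2 p 2)

/-- **On the chart `x₂ ≠ 0` with `b'(Q) = b'₀` the pencil coordinate is `φ(y(Q))`**, `φ(y) = y₂^p − (y₀y₁ + y₀^p + y₁^p)` (`p ≥ 3`).
[cite: CarlsonToledo1999, §6 (kdoublept)] -/
theorem pencilCoord_eq_phi (hp : 3 ≤ p) {Q : ComplexPoints (regularTotal ℂ 2 p)} (hQ : Q ∈ regChartDom 2 p 2)
    (hb : ∀ m : {m : DegIndex 2 p // m ≠ regPowIndex 2 p 2},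
      regCoeff ℂ 2 p Q m.1 = coeffsOf 2 p (cyclicCoverForm p (X 2 ^ (p - 2) * (X 0 * X 1) + X 0 ^ p + X 1 ^ p)) m.1) :
    pencilCoord p Q =
      (fun j => regChartFun 2 p 2 Q (Sum.inr j)) 2 ^ p -
        ((fun j => regChartFun 2 p 2 Q (Sum.inr j)) 0 * (fun j => regChartFun 2 p 2 Q (Sum.inr j)) 1 +
          (fun j => regChartFun 2 p 2 Q (Sum.inr j)) 0 ^ p + (fun j => regChartFun 2 p 2 Q (Sum.inr j)) 1 ^ p) := by
  have hv : regChartFun 2 p 2 Q =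
      Sum.elim (fun m : {m : DegIndex 2 p // m ≠ regPowIndex 2 p 2} =>
        coeffsOf 2 p (cyclicCoverForm p (X 2 ^ (p - 2) * (X 0 * X 1) + X 0 ^ p + X 1 ^ p)) m.1)
        (fun j => regChartFun 2 p 2 Q (Sum.inr j)) := by
    funext s
    rcases s with m | j
    · exact hb m
    · rfl
  have h := congrFun (regCoeff_eq_regChartCoeffVec 2 p 2 hQ) (regPowIndex 2 p 2)
  rw [hv, regChartCoeffVec_nodalPencil_regPowIndex p hp] at h
  rw [pencilCoord, h, neg_neg]

variable (Θ : OpenPartialHomeomorph (Fin (1 + 2) → ℂ) (Fin (1 + 2) → ℂ)) (s₀ r₂ δ R''' R'' : ℝ)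

/-- **Slab points with prescribed remaining coefficients and small pencil coordinate lie in the shell set**: if `b'(Q) = b'₀`,
`s₀² ≤ F(Q) ≤ r₂²` with `r₂² < R''' < R''`, and `|c(Q)| ≤ δ`, then `Q ∈ shellSet p Θ s₀ r₂ δ b'₀` (`p ≥ 3`).
[cite: ArnoldGuseinzadeVarchenko2012, Part I §2.1] -/
theorem mem_shellSet_of_satRadius (hp : 3 ≤ p) (hR : R''' < R'') (hr : r₂ ^ 2 < R''')
    {Q : ComplexPoints (regularTotal ℂ 2 p)}
    (hb : ∀ m : {m : DegIndex 2 p // m ≠ regPowIndex 2 p 2},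
      regCoeff ℂ 2 p Q m.1 = coeffsOf 2 p (cyclicCoverForm p (X 2 ^ (p - 2) * (X 0 * X 1) + X 0 ^ p + X 1 ^ p)) m.1)
    (hlow : s₀ ^ 2 ≤ satRadius p Θ R''' R'' Q) (hup : satRadius p Θ R''' R'' Q ≤ r₂ ^ 2)
    (hc : ‖pencilCoord p Q‖ ≤ δ) :
    Q ∈ shellSet p Θ s₀ r₂ δ (fun m => coeffsOf 2 p (cyclicCoverForm p (X 2 ^ (p - 2) * (X 0 * X 1) + X 0 ^ p + X 1 ^ p)) m.1) := by
  obtain ⟨hQ, hy, hSig⟩ := mem_of_satRadius_lt p Θ R''' R'' hR (lt_of_le_of_lt hup hr)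
  set y : Fin (2 + 1) → ℂ := fun j => regChartFun 2 p 2 Q (Sum.inr j) with hydef
  refine ⟨?_, fun m => hb m⟩
  -- homogeneous coordinates: `[z](Q) = stdChartInv 2 (y Q)` with `y Q` in the affine shell
  have hyC : y ∈ affineShell p Θ s₀ r₂ δ := by
    refine ⟨⟨Θ y, ⟨Θ.map_source hy, ?_, ?_⟩, Θ.left_inv hy⟩, ?_⟩
    · rw [hSig]; exact hlow
    · rw [hSig]; exact hup
    · change ‖y 2 ^ p - (y 0 * y 1 + y 0 ^ p + y 1 ^ p)‖ ≤ δ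
      have h := pencilCoord_eq_phi p hp hQ hb
      rw [← hydef] at h
      rw [← h]; exact hc
  refine ⟨y, hyC, ?_⟩
  -- `stdChartInv 2 y = [z](Q)` since `y = stdChart 2 [z](Q)` and `[z](Q)` is in the chart source
  have hsrc : hypersurfacePoint (regularToProjectiveSpace ℂ 2 p) Q ∈ Projectivization.stdChartSource (𝕜 := ℂ) (2 : Fin 4) := by
    have := hQ; rw [regChartDom_eq_preimage, Set.mem_preimage, Projectivization.stdChart_source] at this; exact this
  have hyeq : y = Projectivization.stdChartFun 2 (hypersurfacePoint (regularToProjectiveSpace ℂ 2 p) Q) := by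
    funext j; rfl
  rw [hyeq, Projectivization.stdChartInv_stdChartFun 2 hsrc]

-- the tangent space of `ℝ` is `ℝ` by definition
set_option backward.isDefEq.respectTransparency false in
/-- **The saturated radius is a first integral of `f • X` at the slab points**, for a field `X` with `dρ̃(X) = 0` on the shell set
(`ρ̃ = regChartExtend 2 p 2 (morseRadiusCutoff Θ R''' R'' ∘ y)`) and any scalar `f`. [cite: ArnoldGuseinzadeVarchenko2012, Part I §1.1] -/
theorem mfderiv_satRadius_smul_eq_zero (hp : 3 ≤ p) (hR : R''' < R'') (hr : r₂ ^ 2 < R''')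
    (X' : haveI := locallyOfFiniteType_regularTotal_hom ℂ 2 p (by omega)
      haveI := smoothOfRelativeDimension_regularTotal_hom ℂ 2 p (by omega)
      letI := ComplexPoints.chartedSpace (regularTotal ℂ 2 p) (2 + Fintype.card (DegIndex 2 p))
      Π Q : ComplexPoints (regularTotal ℂ 2 p), TangentSpace (𝓡 (2 * (2 + Fintype.card (DegIndex 2 p)))) Q)
    (f : ComplexPoints (regularTotal ℂ 2 p) → ℝ)
    (hX' : haveI := locallyOfFiniteType_regularTotal_hom ℂ 2 p (by omega)
      haveI := smoothOfRelativeDimension_regularTotal_hom ℂ 2 p (by omega)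
      letI := ComplexPoints.chartedSpace (regularTotal ℂ 2 p) (2 + Fintype.card (DegIndex 2 p))
      ∀ Q ∈ shellSet p Θ s₀ r₂ δ (fun m => coeffsOf 2 p (cyclicCoverForm p (X 2 ^ (p - 2) * (X 0 * X 1) + X 0 ^ p + X 1 ^ p)) m.1),
        mfderiv (𝓡 (2 * (2 + Fintype.card (DegIndex 2 p)))) 𝓘(ℝ, ℝ)
          (regChartExtend 2 p 2 (fun v => PhamBrieskorn.morseRadiusCutoff Θ R''' R'' (fun j => v (Sum.inr j)))) Q (X' Q) = 0)
    {Q : ComplexPoints (regularTotal ℂ 2 p)}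
    (hb : ∀ m : {m : DegIndex 2 p // m ≠ regPowIndex 2 p 2},
      regCoeff ℂ 2 p Q m.1 = coeffsOf 2 p (cyclicCoverForm p (X 2 ^ (p - 2) * (X 0 * X 1) + X 0 ^ p + X 1 ^ p)) m.1)
    (hlow : s₀ ^ 2 ≤ satRadius p Θ R''' R'' Q) (hup : satRadius p Θ R''' R'' Q ≤ r₂ ^ 2) (hc : ‖pencilCoord p Q‖ ≤ δ) :
    haveI := locallyOfFiniteType_regularTotal_hom ℂ 2 p (by omega)
    haveI := smoothOfRelativeDimension_regularTotal_hom ℂ 2 p (by omega)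
    letI := ComplexPoints.chartedSpace (regularTotal ℂ 2 p) (2 + Fintype.card (DegIndex 2 p))
    mfderiv (𝓡 (2 * (2 + Fintype.card (DegIndex 2 p)))) 𝓘(ℝ, ℝ) (satRadius p Θ R''' R'') Q (f Q • X' Q) = 0 := by
  haveI := locallyOfFiniteType_regularTotal_hom ℂ 2 p (by omega)
  haveI := smoothOfRelativeDimension_regularTotal_hom ℂ 2 p (by omega)
  letI := ComplexPoints.chartedSpace (regularTotal ℂ 2 p) (2 + Fintype.card (DegIndex 2 p))
  obtain ⟨hQ, hy, hSig⟩ := mem_of_satRadius_lt p Θ R''' R'' hR (lt_of_le_of_lt hup hr)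
  have hlt : ∑ i, ‖Θ (fun j => regChartFun 2 p 2 Q (Sum.inr j)) i‖ ^ 2 < R''' := by rw [hSig]; exact lt_of_le_of_lt hup hr
  have h0 := hX' Q (mem_shellSet_of_satRadius p Θ s₀ r₂ δ R''' R'' hp hR hr hb hlow hup hc)
  rw [mfderiv_satRadius_eq p Θ R''' R'' (by omega) hR hQ hy hlt, map_smul]
  exact (congrArg (fun t : ℝ => f Q • t) h0).trans (smul_zero _)

/-- If two coefficient vectors agree off `m₀`, the sup norm of their difference is the norm of the `m₀`-difference.
[cite: BrockerJanichIDT1982, (8.12)] -/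
theorem norm_sub_eq_of_forall_ne {ι : Type*} [Fintype ι] [DecidableEq ι] (b b₀ : ι → ℂ) (m₀ : ι)
    (h : ∀ m, m ≠ m₀ → b m = b₀ m) : ‖b - b₀‖ = ‖b m₀ - b₀ m₀‖ := by
  have heq : b - b₀ = Pi.single m₀ (b m₀ - b₀ m₀) := by
    funext m
    by_cases hm : m = m₀
    · subst hm; simp
    · simp [hm, h m hm]
  rw [heq, Pi.norm_single]

/-- **`(b₀)_{x₂^p} = 0`** for the coefficient vector of `x₃^p − f₁`, `f₁ = x₂^{p−2}x₀x₁ + x₀^p + x₁^p`, `p ≥ 3`.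
[cite: ArnoldGuseinzadeVarchenko2012, Part I §2.1] -/
theorem coeffsOf_nodal_regPowIndex (hp : 3 ≤ p) :
    coeffsOf 2 p (cyclicCoverForm p (X 2 ^ (p - 2) * (X 0 * X 1) + X 0 ^ p + X 1 ^ p)) (regPowIndex 2 p 2) = 0 := by
  obtain ⟨m, rfl⟩ : ∃ m, p = m + 3 := ⟨p - 3, by omega⟩
  rw [coeffsOf_apply]
  change MvPolynomial.coeff (Finsupp.single (2 : Fin 4) (m + 3)) _ = 0
  rw [coeff_cyclicCoverForm_single_two (m + 3) (by omega), neg_eq_zero,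
    MvPolynomial.coeff_add, MvPolynomial.coeff_add, MvPolynomial.coeff_X_pow, MvPolynomial.coeff_X_pow]
  have h0 : Finsupp.single (0 : Fin 3) (m + 3) ≠ Finsupp.single (2 : Fin 3) (m + 3) := by
    intro h; have := (Finsupp.single_left_injective (by omega : m + 3 ≠ 0)).eq_iff.mp h; exact absurd this (by decide)
  have h1 : Finsupp.single (1 : Fin 3) (m + 3) ≠ Finsupp.single (2 : Fin 3) (m + 3) := by
    intro h; have := (Finsupp.single_left_injective (by omega : m + 3 ≠ 0)).eq_iff.mp h; exact absurd this (by decide)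
  rw [if_neg h0, if_neg h1, add_zero, add_zero]
  rw [show (X 2 ^ (m + 3 - 2) * (X 0 * X 1) : MvPolynomial (Fin 3) ℂ) = X 0 * (X 1 * X 2 ^ (m + 3 - 2)) by ring,
    MvPolynomial.coeff_X_mul', if_neg]
  rw [Finsupp.mem_support_iff, Finsupp.single_apply, if_neg (by decide)]
  exact fun h => h rfl

variable (s₁ : ℝ)

/-- **The invariant set** `A = {b'(Q) = b'₀} ∩ {s₁² < F(Q)}` (outside the Morse ball of radius `s₁`, on the pencil).
[cite: ArnoldGuseinzadeVarchenko2012, Part I §2.1] -/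
def invariantSet : Set (ComplexPoints (regularTotal ℂ 2 p)) :=
  {Q | (∀ m : {m : DegIndex 2 p // m ≠ regPowIndex 2 p 2},
      regCoeff ℂ 2 p Q m.1 = coeffsOf 2 p (cyclicCoverForm p (X 2 ^ (p - 2) * (X 0 * X 1) + X 0 ^ p + X 1 ^ p)) m.1) ∧
    s₁ ^ 2 < satRadius p Θ R''' R'' Q}


/-! ### Along the orbits of a cut-off lift -/

section Orbit

variable {p} {Θ} {s₀ r₂ δ R''' R''} {s₁}
variable (hp : 3 ≤ p)
  (β : (Fin (2 + 1) → ℂ) → ℝ) (χ' : (DegIndex 2 p → ℂ) → ℝ) {W : (DegIndex 2 p → ℂ) → (DegIndex 2 p → ℂ)}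
  (X' : haveI := locallyOfFiniteType_regularTotal_hom ℂ 2 p (by omega)
    haveI := smoothOfRelativeDimension_regularTotal_hom ℂ 2 p (by omega)
    letI := ComplexPoints.chartedSpace (regularTotal ℂ 2 p) (2 + Fintype.card (DegIndex 2 p))
    Π Q : ComplexPoints (regularTotal ℂ 2 p), TangentSpace (𝓡 (2 * (2 + Fintype.card (DegIndex 2 p)))) Q)
  (hXW : haveI := locallyOfFiniteType_regularTotal_hom ℂ 2 p (by omega)
    haveI := smoothOfRelativeDimension_regularTotal_hom ℂ 2 p (by omega)
    letI := ComplexPoints.chartedSpace (regularTotal ℂ 2 p) (2 + Fintype.card (DegIndex 2 p))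
    ∀ Q, mfderiv (𝓡 (2 * (2 + Fintype.card (DegIndex 2 p)))) 𝓘(ℝ, DegIndex 2 p → ℂ) (fun Q' => regCoeff ℂ 2 p Q') Q (X' Q) =
      W (regCoeff ℂ 2 p Q))
  (hW' : ∀ b (m : DegIndex 2 p), m ≠ regPowIndex 2 p 2 → W b m = 0)
  {γ : ℝ → ComplexPoints (regularTotal ℂ 2 p)}
  (hγ : haveI := locallyOfFiniteType_regularTotal_hom ℂ 2 p (by omega)
    haveI := smoothOfRelativeDimension_regularTotal_hom ℂ 2 p (by omega)
    letI := ComplexPoints.chartedSpace (regularTotal ℂ 2 p) (2 + Fintype.card (DegIndex 2 p))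
    IsMIntegralCurve γ (fun Q' => cutoffScalar p β χ' Q' • X' Q'))
  (h0 : γ 0 ∈ invariantSet p Θ R''' R'' s₁)
include hp hXW hW' hγ h0

/-- **The remaining coefficients are conserved along the orbit.** [cite: BrockerJanichIDT1982, (8.12)] -/
theorem regCoeff_orbit_eq (s : ℝ) (m : {m : DegIndex 2 p // m ≠ regPowIndex 2 p 2}) :
    regCoeff ℂ 2 p (γ s) m.1 = coeffsOf 2 p (cyclicCoverForm p (X 2 ^ (p - 2) * (X 0 * X 1) + X 0 ^ p + X 1 ^ p)) m.1 := by
  rw [← h0.1 m]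
  exact regCoeff_apply_integralCurve_const 2 p (by omega) X' (cutoffScalar p β χ') hXW (fun b => hW' b m.1 m.2) hγ 0 s

variable {ρK : ℝ} (hR : R''' < R'') (hr : r₂ ^ 2 < R''')
  (hχK : ∀ b, χ' b ≠ 0 →
    ‖b - coeffsOf 2 p (cyclicCoverForm p (X 2 ^ (p - 2) * (X 0 * X 1) + X 0 ^ p + X 1 ^ p))‖ < ρK)
  (hρδ : ρK ≤ δ)
  (hXK : haveI := locallyOfFiniteType_regularTotal_hom ℂ 2 p (by omega)
    haveI := smoothOfRelativeDimension_regularTotal_hom ℂ 2 p (by omega)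
    letI := ComplexPoints.chartedSpace (regularTotal ℂ 2 p) (2 + Fintype.card (DegIndex 2 p))
    ∀ Q ∈ shellSet p Θ s₀ r₂ δ (fun m => coeffsOf 2 p (cyclicCoverForm p (X 2 ^ (p - 2) * (X 0 * X 1) + X 0 ^ p + X 1 ^ p)) m.1),
      mfderiv (𝓡 (2 * (2 + Fintype.card (DegIndex 2 p)))) 𝓘(ℝ, ℝ)
        (regChartExtend 2 p 2 (fun v => PhamBrieskorn.morseRadiusCutoff Θ R''' R'' (fun j => v (Sum.inr j)))) Q (X' Q) = 0)
include hR hr hχK hρδ hXK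

-- the tangent space of `ℝ` is `ℝ` by definition
set_option backward.isDefEq.respectTransparency false in
/-- **The saturated radius is a first integral at every slab point of the orbit** (`supp χ'` has radius `ρK ≤ δ`, the shell parameter).
[cite: ArnoldGuseinzadeVarchenko2012, Part I §1.1] -/
theorem mfderiv_satRadius_orbit_eq_zero (s : ℝ) (hlow : s₀ ^ 2 < satRadius p Θ R''' R'' (γ s))
    (hup : satRadius p Θ R''' R'' (γ s) < r₂ ^ 2) :
    haveI := locallyOfFiniteType_regularTotal_hom ℂ 2 p (by omega)
    haveI := smoothOfRelativeDimension_regularTotal_hom ℂ 2 p (by omega)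
    letI := ComplexPoints.chartedSpace (regularTotal ℂ 2 p) (2 + Fintype.card (DegIndex 2 p))
    mfderiv (𝓡 (2 * (2 + Fintype.card (DegIndex 2 p)))) 𝓘(ℝ, ℝ) (satRadius p Θ R''' R'') (γ s)
      (cutoffScalar p β χ' (γ s) • X' (γ s)) = 0 := by
  haveI := locallyOfFiniteType_regularTotal_hom ℂ 2 p (by omega)
  haveI := smoothOfRelativeDimension_regularTotal_hom ℂ 2 p (by omega)
  letI := ComplexPoints.chartedSpace (regularTotal ℂ 2 p) (2 + Fintype.card (DegIndex 2 p))
  have hb := regCoeff_orbit_eq hp β χ' X' hXW hW' hγ h0 s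
  by_cases hχ : χ' (regCoeff ℂ 2 p (γ s)) = 0
  · have hf : cutoffScalar p β χ' (γ s) = 0 := by rw [cutoffScalar, hχ, mul_zero]
    rw [hf, zero_smul, map_zero]
  · have hnorm := hχK _ hχ
    rw [norm_sub_eq_of_forall_ne _ _ (regPowIndex 2 p 2) (fun m hm => hb ⟨m, hm⟩), coeffsOf_nodal_regPowIndex p hp,
      sub_zero] at hnorm
    have hc : ‖pencilCoord p (γ s)‖ ≤ δ := by
      rw [pencilCoord, norm_neg]; exact (hnorm.trans_le hρδ).le
    exact mfderiv_satRadius_smul_eq_zero p Θ s₀ r₂ δ R''' R'' hp hR hr X' (cutoffScalar p β χ') hXK hb hlow.le hup.le hc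

variable (hΘ : ContDiffOn ℝ ∞ Θ Θ.source) (hR'' : {z : Fin (1 + 2) → ℂ | ∑ i, ‖z i‖ ^ 2 ≤ R''} ⊆ Θ.target)
  (hs₀₁ : s₀ ^ 2 < s₁ ^ 2) (hs₁r : s₁ ^ 2 < r₂ ^ 2)
include hΘ hR'' hs₀₁ hs₁r

/-- **Invariance: the orbit stays outside the Morse ball of radius `s₁`** — `s₁² < F(γ s)` for all `s`.
[cite: ArnoldGuseinzadeVarchenko2012, Part I §1.1 (held text p0025)] -/
theorem satRadius_orbit_gt (s : ℝ) : s₁ ^ 2 < satRadius p Θ R''' R'' (γ s) := by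
  haveI := locallyOfFiniteType_regularTotal_hom ℂ 2 p (by omega)
  haveI := smoothOfRelativeDimension_regularTotal_hom ℂ 2 p (by omega)
  letI := ComplexPoints.chartedSpace (regularTotal ℂ 2 p) (2 + Fintype.card (DegIndex 2 p))
  haveI := ComplexPoints.isManifold_real (regularTotal ℂ 2 p) (2 + Fintype.card (DegIndex 2 p))
  have hF : ContMDiff (𝓡 (2 * (2 + Fintype.card (DegIndex 2 p)))) 𝓘(ℝ, ℝ) 1 (satRadius p Θ R''' R'') :=
    (contMDiff_satRadius p Θ R''' R'' (by omega) hΘ hR hR'').of_le (by simp)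
  exact apply_integralCurve_gt_of_gt_on (I := 𝓡 (2 * (2 + Fintype.card (DegIndex 2 p)))) hF isOpen_univ Set.ordConnected_univ
    (hγ.isMIntegralCurveOn _)
    (fun r _ hlo hhi => mfderiv_satRadius_orbit_eq_zero hp β χ' X' hXW hW' hγ h0 hR hr hχK hρδ hXK r hlo hhi)
    hs₀₁ hs₁r (Set.mem_univ 0) h0.2 (Set.mem_univ s)

/-- **The orbit stays in the invariant set `A`.** [cite: ArnoldGuseinzadeVarchenko2012, Part I §2.1] -/
theorem orbit_mem_invariantSet (s : ℝ) : γ s ∈ invariantSet p Θ R''' R'' s₁ :=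
  ⟨fun m => regCoeff_orbit_eq hp β χ' X' hXW hW' hγ h0 s m,
    satRadius_orbit_gt hp β χ' X' hXW hW' hγ h0 hR hr hχK hρδ hXK hΘ hR'' hs₀₁ hs₁r s⟩

variable (hβ : ∀ y, β y ≠ 0 → y ∈ Θ.source ∧ ∑ i, ‖Θ y i‖ ^ 2 < s₀ ^ 2)
include hβ

/-- **The node cut-off vanishes along the orbit** (`β` is supported where the Morse radius is `< s₀²`).
[cite: ArnoldGuseinzadeVarchenko2012, Part I §2.1] -/
theorem nodeCutoff_orbit_eq_zero (s : ℝ) :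
    regChartExtend 2 p 2 (fun v => β (fun j => v (Sum.inr j))) (γ s) = 0 := by
  by_cases hQ : γ s ∈ regChartDom 2 p 2
  · rw [regChartExtend_of_mem 2 p 2 _ hQ]
    by_contra hne
    obtain ⟨hy, hlt⟩ := hβ _ hne
    have hF := satRadius_eq_of_le p Θ R''' R'' hR hQ hy (hlt.le.trans (hs₀₁.le.trans (hs₁r.le.trans hr.le)))
    have hgt := satRadius_orbit_gt hp β χ' X' hXW hW' hγ h0 hR hr hχK hρδ hXK hΘ hR'' hs₀₁ hs₁r s
    rw [hF] at hgt
    linarith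
  · exact regChartExtend_of_not_mem 2 p 2 _ hQ

/-- **Hence the cut-off scalar along the orbit is `χ'(b(γ s))`.** [cite: ArnoldGuseinzadeVarchenko2012, Part I §2.1] -/
theorem cutoffScalar_orbit_eq (s : ℝ) : cutoffScalar p β χ' (γ s) = χ' (regCoeff ℂ 2 p (γ s)) :=
  cutoffScalar_eq_of p β χ' (nodeCutoff_orbit_eq_zero hp β χ' X' hXW hW' hγ h0 hR hr hχK hρδ hXK hΘ hR'' hs₀₁ hs₁r hβ s)

end Orbit

end Literature.AlgebraicGeometry.HodgeTheory

end
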